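import Literature.Barriers.Parity.MaynardFunctionalCeiling
import Literature.NumberTheory.Sieve.PolymathMkEpsUpperBound
import HarnessLib

/-!
# `MaynardFunctionalCeiling` — companion ("Proofs") file: Soundararajan's ceiling `4` for the
# Goldston–Pintz–Yıldırım weights (`Soundararajan2007_gpyCeiling_holds`) and Polymath 8b Proposition 6.5
# (`Polymath2014_epsFunctional_le_holds`)

Topic `Literature/Barriers/Parity`, companion of `MaynardFunctionalCeiling.lean` (barrier catalogue
entry for the summit `Parity`: the ceilings of the Selberg-sieve functionals), kept separate so that
the statement file is unchanged. All declarations here are PROVED theorems; no new definitions;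
imports `MaynardFunctionalCeiling` and (for the second discharge) `Literature.NumberTheory.Sieve.PolymathMkEpsUpperBound`.

Discharged here: (1) the named fact `Literature.Barriers.Parity.Soundararajan2007_gpyCeiling` — item (iv) of the
BARRIER block of `Literature.Barriers.Parity.MaynardFunctionalCeiling`, the predecessor ceiling for the
one-dimensional GPY weights `λ_d = μ(d) P(log(R/d)/log R)`; (2) the named fact
`Literature.Barriers.Parity.Polymath2014_epsFunctional_le` — Polymath 8b Proposition 6.5, the printed ceiling
`M_{k,ε} ≤ (k/(k-1)) log(2k-1)` of evasion (a) of that BARRIER block — see the last section of this file.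

## What the source prints (verified on the page; arXiv page numbers)

K. Soundararajan, *Small gaps between prime numbers: the work of Goldston–Pintz–Yıldırım*,
Bull. Amer. Math. Soc. 44 (2007) 1–18 = arXiv:math/0605696, p. 8
[cite: Soundararajan2007SmallGaps, p. 8]: "Unfortunately, the second fraction in (12) cannot be
made larger than `4/k`. If we set `Q(y) = P^{(k-1)}(y)` then `Q` is a polynomial, not identically
zero, with `Q(0) = 0`; for such polynomials `Q` we claim that the unfortunate inequality
`∫₀¹ (y^{k-2}/(k-2)!) Q(1-y)² dy < (4/k) ∫₀¹ (y^{k-1}/(k-1)!) Q′(1-y)² dy`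
holds. The reader can try her hand at proving this."  Here `k ≥ 2` is the size of the tuple
`{h₁, …, h_k}` (p. 7) and (12) is the ratio
`(log R/log x) · (∫₀¹ y^{k-2}/(k-2)! P^{(k-1)}(1-y)² dy)/(∫₀¹ y^{k-1}/(k-1)! P^{(k)}(1-y)² dy)`,
which must exceed `1/k` for the argument to produce prime pairs.

## The proof (the source prints none; a weighted Hardy inequality by a ground-state identity)

Write `k = n + 2` and `G(y) := Q(1 - y)`, a nonzero real polynomial with `G(1) = Q(0) = 0` and
`G'(y)² = Q'(1-y)²`. Clearing the factorials, the claim is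
`(n+2)(n+1) ∫₀¹ yⁿ G² < 4 ∫₀¹ y^{n+1} G'²` (`SoundararajanCeiling.hardy_polynomial`). It follows by
integrating over `[0, 1]` the pointwise polynomial identity (`SoundararajanCeiling.pointwise_identity`)
`4 y^{n+1} G'² - (n+2)(n+1) yⁿ G²`
`  = 4 y^{n+1} (G' + ((n+2)/4)(1+y) G)² + ((n+2)²/4) y^{n+1} (1-y)(3+y) G² + Φ'`,
`Φ := -(n+2) y^{n+1} (1+y) G²` — the completion of the square along the logarithmic derivative
`ψ = -(k/4)(1+y)` of a supersolution of the Euler–Lagrange equation `y φ'' + (k-1) φ' + (k(k-1)/4) φ = 0`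
of the quotient. The exact derivative integrates to `Φ(1) - Φ(0) = -2(n+2) G(1)² - 0 = 0`
(fundamental theorem of calculus, `intervalIntegral.integral_eq_sub_of_hasDerivAt`), and the
remainder is a continuous function, nonnegative on `[0, 1]` and strictly positive at every point of
`(0, 1)` where `G ≠ 0`; such points exist since `G ≠ 0` has finitely many roots, so the integral of
the remainder is positive (`intervalIntegral.integral_lt_integral_of_continuousOn_of_le_of_exists_lt`).
Only the printed strict inequality with the constant `4/k` is proved; nothing is asserted here about
the optimal constant (the source: for `P(y) = y^{k+r}` the fraction is
`2(2r+1)/((r+1)(k+2r+1))`, "largest when `r` is about `√k/2`, and … close to but less than `4/k`").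
The source's reading — "the second fraction in (12) cannot be made larger than `4/k`" for `P`
vanishing to order `≥ k` at `0` — is the corollary `Soundararajan2007_gpyCeiling.fraction_lt`
(`Q = P^{(k-1)}`).
-/

noncomputable section

open MeasureTheory Polynomial

namespace Literature.Barriers.Parity

namespace SoundararajanCeiling

/-- **Ground-state identity** for the weighted Hardy inequality behind Soundararajan's ceiling: for a
real polynomial `G`, a natural number `n` (`k = n + 2`) and every real `y`,
`4 y^{n+1} G'(y)² - (n+2)(n+1) yⁿ G(y)²`
`  = 4 y^{n+1} (G'(y) + ((n+2)/4)(1+y) G(y))² + ((n+2)²/4) y^{n+1} (1-y)(3+y) G(y)² + Φ'(y)`,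
where `Φ = -(n+2) X^{n+1} (1+X) G²` and `Φ'` is its (formal) derivative. [folklore] -/
theorem pointwise_identity (n : ℕ) (G : ℝ[X]) (y : ℝ) :
    4 * (y ^ (n + 1) * ((derivative G).eval y) ^ 2)
        - ((n : ℝ) + 2) * ((n : ℝ) + 1) * (y ^ n * (G.eval y) ^ 2)
      = (4 * y ^ (n + 1) * ((derivative G).eval y + ((n : ℝ) + 2) / 4 * (1 + y) * G.eval y) ^ 2
          + ((n : ℝ) + 2) ^ 2 / 4 * y ^ (n + 1) * (1 - y) * (3 + y) * (G.eval y) ^ 2)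
        + (derivative (C (-((n : ℝ) + 2)) * X ^ (n + 1) * (1 + X) * G ^ 2)).eval y := by
  simp only [derivative_mul, derivative_C, zero_mul, zero_add, derivative_X_pow_succ,
    derivative_add, derivative_one, derivative_X, derivative_sq, eval_mul, eval_add, eval_C,
    eval_X, eval_pow, eval_one, mul_one]
  ring

/-- **Weighted Hardy inequality for polynomials vanishing at `1`**: for a nonzero real polynomial
`G` with `G(1) = 0` and every `n : ℕ`,
`(n+2)(n+1) ∫₀¹ yⁿ G(y)² dy < 4 ∫₀¹ y^{n+1} G'(y)² dy`.
Integrate `pointwise_identity` over `[0, 1]`: the exact derivative contributes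
`Φ(1) - Φ(0) = -2(n+2) G(1)² = 0`, the remainder is nonnegative on `[0, 1]` and positive at any
point of `(0, 1)` that is not one of the finitely many roots of `G`. [folklore] -/
theorem hardy_polynomial (n : ℕ) {G : ℝ[X]} (hG0 : G ≠ 0) (hG1 : G.eval 1 = 0) :
    ((n : ℝ) + 2) * ((n : ℝ) + 1) * (∫ y in (0 : ℝ)..1, y ^ n * (G.eval y) ^ 2)
      < 4 * ∫ y in (0 : ℝ)..1, y ^ (n + 1) * ((derivative G).eval y) ^ 2 := by
  set Φ : ℝ[X] := C (-((n : ℝ) + 2)) * X ^ (n + 1) * (1 + X) * G ^ 2 with hΦ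
  set R : ℝ → ℝ := fun y =>
    4 * y ^ (n + 1) * ((derivative G).eval y + ((n : ℝ) + 2) / 4 * (1 + y) * G.eval y) ^ 2
      + ((n : ℝ) + 2) ^ 2 / 4 * y ^ (n + 1) * (1 - y) * (3 + y) * (G.eval y) ^ 2 with hR
  have hRc : Continuous R := by
    rw [hR]
    fun_prop
  have hIint : IntervalIntegrable (fun y : ℝ => y ^ n * (G.eval y) ^ 2) volume 0 1 :=
    (by fun_prop : Continuous fun y : ℝ => y ^ n * (G.eval y) ^ 2).intervalIntegrable _ _
  have hJint : IntervalIntegrable (fun y : ℝ => y ^ (n + 1) * ((derivative G).eval y) ^ 2)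
      volume 0 1 :=
    (by fun_prop : Continuous fun y : ℝ => y ^ (n + 1) * ((derivative G).eval y) ^ 2)
      |>.intervalIntegrable _ _
  have hΦ'int : IntervalIntegrable (fun y : ℝ => (derivative Φ).eval y) volume 0 1 :=
    (derivative Φ).continuous.intervalIntegrable _ _
  -- the exact derivative integrates to `Φ(1) - Φ(0) = 0`
  have hFTC : ∫ y in (0 : ℝ)..1, (derivative Φ).eval y = 0 := by
    rw [intervalIntegral.integral_eq_sub_of_hasDerivAt (fun x _ => Φ.hasDerivAt x) hΦ'int]
    simp [hΦ, hG1]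
  -- integrate the pointwise identity
  have hdiff : 4 * (∫ y in (0 : ℝ)..1, y ^ (n + 1) * ((derivative G).eval y) ^ 2)
      - ((n : ℝ) + 2) * ((n : ℝ) + 1) * (∫ y in (0 : ℝ)..1, y ^ n * (G.eval y) ^ 2)
        = ∫ y in (0 : ℝ)..1, R y := by
    rw [← intervalIntegral.integral_const_mul, ← intervalIntegral.integral_const_mul,
      ← intervalIntegral.integral_sub (hJint.const_mul _) (hIint.const_mul _)]
    have hcongr : ∫ y in (0 : ℝ)..1, (4 * (y ^ (n + 1) * ((derivative G).eval y) ^ 2)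
        - ((n : ℝ) + 2) * ((n : ℝ) + 1) * (y ^ n * (G.eval y) ^ 2))
          = ∫ y in (0 : ℝ)..1, (R y + (derivative Φ).eval y) :=
      intervalIntegral.integral_congr fun y _ => pointwise_identity n G y
    rw [hcongr, intervalIntegral.integral_add (hRc.intervalIntegrable _ _) hΦ'int, hFTC, add_zero]
  -- a point of `(0, 1)` where `G` does not vanish (`G ≠ 0` has finitely many roots)
  obtain ⟨y₀, hy₀, hGy₀⟩ : ∃ y₀ ∈ Set.Ioo (0 : ℝ) 1, G.eval y₀ ≠ 0 := by
    by_contra h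
    push Not at h
    exact hG0 (Polynomial.eq_zero_of_infinite_isRoot G
      ((Set.Ioo_infinite zero_lt_one).mono fun y hy => h y hy))
  -- the remainder is nonnegative on `[0, 1]` and positive at `y₀`
  have hRnonneg : ∀ y ∈ Set.Ioc (0 : ℝ) 1, 0 ≤ R y := by
    intro y hy
    have hy0 : 0 ≤ y := hy.1.le
    have hy1 : 0 ≤ 1 - y := sub_nonneg.2 hy.2
    simp only [hR]
    exact add_nonneg (by positivity) (mul_nonneg (mul_nonneg (mul_nonneg (mul_nonneg
      (by positivity) (by positivity)) hy1) (by positivity)) (sq_nonneg _))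
  have hRpos : 0 < R y₀ := by
    have hy0 : 0 < y₀ := hy₀.1
    have hy1 : 0 < 1 - y₀ := sub_pos.2 hy₀.2
    have hsq : 0 < (G.eval y₀) ^ 2 := by positivity
    simp only [hR]
    exact add_pos_of_nonneg_of_pos (by positivity) (mul_pos (mul_pos (mul_pos (mul_pos
      (by positivity) (by positivity)) hy1) (by positivity)) hsq)
  have hint : 0 < ∫ y in (0 : ℝ)..1, R y := by
    have h := intervalIntegral.integral_lt_integral_of_continuousOn_of_le_of_exists_lt
      (f := fun _ => (0 : ℝ)) zero_lt_one continuousOn_const hRc.continuousOn hRnonneg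
      ⟨y₀, Set.Ioo_subset_Icc_self hy₀, hRpos⟩
    simpa using h
  linarith [hdiff, hint]

end SoundararajanCeiling

open SoundararajanCeiling in
/-- **Soundararajan's "unfortunate inequality" holds**: for every `k ≥ 2` and every real
polynomial `Q`, not identically zero, with `Q(0) = 0`,
`∫₀¹ (y^{k-2}/(k-2)!) Q(1-y)² dy < (4/k) ∫₀¹ (y^{k-1}/(k-1)!) Q′(1-y)² dy`
— the named fact `Soundararajan2007_gpyCeiling` of `MaynardFunctionalCeiling.lean`, as printed
("for such polynomials `Q` we claim that the unfortunate inequality … holds. The reader can try her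
hand at proving this"; no proof is printed). Proof: with `G(y) = Q(1-y)` (`G ≠ 0`, `G(1) = 0`,
`G'(y)² = Q'(1-y)²`) and `k = n + 2` the two sides are `(∫₀¹ yⁿ G²)/n!` and
`(4/(n+2)) (∫₀¹ y^{n+1} G'²)/(n+1)!`, so the claim is `(n+2)(n+1) ∫₀¹ yⁿ G² < 4 ∫₀¹ y^{n+1} G'²`,
which is `SoundararajanCeiling.hardy_polynomial`. [cite: Soundararajan2007SmallGaps, p. 8] -/
theorem Soundararajan2007_gpyCeiling_holds : Soundararajan2007_gpyCeiling := by
  intro k hk Q hQ hQ0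
  obtain ⟨n, rfl⟩ : ∃ n, k = n + 2 := ⟨k - 2, by omega⟩
  -- `G(y) = Q(1 - y)`
  set G : ℝ[X] := Q.comp (1 - X) with hG
  have hGe : ∀ y : ℝ, G.eval y = Q.eval (1 - y) := fun y => by simp [hG, eval_comp]
  have hGd : ∀ y : ℝ, (derivative G).eval y = -((derivative Q).eval (1 - y)) := fun y => by
    simp [hG, derivative_comp, eval_comp]
  have hG1 : G.eval 1 = 0 := by simp [hGe, hQ0]
  have hG0 : G ≠ 0 := by
    intro h
    apply hQ
    refine Polynomial.funext fun r => ?_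
    have := hGe (1 - r)
    rw [h, sub_sub_cancel, eval_zero] at this
    rw [eval_zero, ← this]
  have key := hardy_polynomial n hG0 hG1
  -- rewrite both sides of the claim in terms of `G`
  have h2 : n + 2 - 2 = n := rfl
  have h1 : n + 2 - 1 = n + 1 := rfl
  simp only [h2, h1]
  have hL : (∫ y in (0 : ℝ)..1, y ^ n / (n.factorial : ℝ) * (Q.eval (1 - y)) ^ 2)
      = (n.factorial : ℝ)⁻¹ * ∫ y in (0 : ℝ)..1, y ^ n * (G.eval y) ^ 2 := by
    rw [← intervalIntegral.integral_const_mul]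
    refine intervalIntegral.integral_congr fun y _ => ?_
    simp only [hGe]
    ring
  have hR : (∫ y in (0 : ℝ)..1,
      y ^ (n + 1) / ((n + 1).factorial : ℝ) * ((derivative Q).eval (1 - y)) ^ 2)
      = ((n + 1).factorial : ℝ)⁻¹
          * ∫ y in (0 : ℝ)..1, y ^ (n + 1) * ((derivative G).eval y) ^ 2 := by
    rw [← intervalIntegral.integral_const_mul]
    refine intervalIntegral.integral_congr fun y _ => ?_
    simp only [hGd]
    ring
  rw [hL, hR, Nat.factorial_succ, Nat.cast_mul]
  push_cast
  have hf : (0 : ℝ) < n.factorial := by exact_mod_cast Nat.factorial_pos n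
  have hn1 : (0 : ℝ) < (n : ℝ) + 1 := by positivity
  have hn2 : (0 : ℝ) < (n : ℝ) + 2 := by positivity
  rw [mul_inv, show (4 : ℝ) / ((n : ℝ) + 2) * ((((n : ℝ) + 1)⁻¹ * (n.factorial : ℝ)⁻¹)
      * ∫ y in (0 : ℝ)..1, y ^ (n + 1) * ((derivative G).eval y) ^ 2)
      = (n.factorial : ℝ)⁻¹ * ((4 * ∫ y in (0 : ℝ)..1, y ^ (n + 1) * ((derivative G).eval y) ^ 2)
        / (((n : ℝ) + 2) * ((n : ℝ) + 1))) by field_simp]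
  refine mul_lt_mul_of_pos_left ?_ (inv_pos.2 hf)
  rw [lt_div_iff₀ (mul_pos hn2 hn1)]
  linarith [key]

/-- **"The second fraction in (12) cannot be made larger than `4/k`"** (the source's use of the
inequality): for `k ≥ 2` and a real polynomial `P` vanishing to order at least `k` at `0`
(`X^k ∣ P`, "`P` vanishes to order at least `k` at `y = 0`", p. 7) with `P^{(k-1)} ≢ 0`,
`(∫₀¹ y^{k-2}/(k-2)! P^{(k-1)}(1-y)² dy)/(∫₀¹ y^{k-1}/(k-1)! P^{(k)}(1-y)² dy) < 4/k`,
from `Soundararajan2007_gpyCeiling_holds` with `Q = P^{(k-1)}` (`Q(0) = 0` since `X ∣ P^{(k-1)}`,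
`Q' = P^{(k)}`); the denominator is then positive (the numerator is `≥ 0` and `<` `(4/k)` times it).
[cite: Soundararajan2007SmallGaps, p. 8] -/
theorem Soundararajan2007_gpyCeiling.fraction_lt {k : ℕ} (hk : 2 ≤ k) {P : ℝ[X]}
    (hP : X ^ k ∣ P) (hPk : derivative^[k - 1] P ≠ 0) :
    (∫ y in (0 : ℝ)..1, y ^ (k - 2) / ((k - 2).factorial : ℝ)
        * ((derivative^[k - 1] P).eval (1 - y)) ^ 2)
      / (∫ y in (0 : ℝ)..1, y ^ (k - 1) / ((k - 1).factorial : ℝ)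
        * ((derivative^[k] P).eval (1 - y)) ^ 2) < 4 / (k : ℝ) := by
  have hQ0 : (derivative^[k - 1] P).eval 0 = 0 := by
    have hdvd : X ^ (k - (k - 1)) ∣ derivative^[k - 1] P :=
      pow_sub_dvd_iterate_derivative_of_pow_dvd (k - 1) hP
    rw [show k - (k - 1) = 1 by omega, pow_one, X_dvd_iff, coeff_zero_eq_eval_zero] at hdvd
    exact hdvd
  have hQ' : derivative (derivative^[k - 1] P) = derivative^[k] P := by
    rw [← Function.iterate_succ_apply' derivative (k - 1) P]
    congr 1
    omega
  have hlt := Soundararajan2007_gpyCeiling_holds k hk _ hPk hQ0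
  rw [hQ'] at hlt
  have hnum : 0 ≤ ∫ y in (0 : ℝ)..1, y ^ (k - 2) / ((k - 2).factorial : ℝ)
      * ((derivative^[k - 1] P).eval (1 - y)) ^ 2 :=
    intervalIntegral.integral_nonneg zero_le_one fun y hy => by
      have := hy.1
      positivity
  have hk0 : (0 : ℝ) < 4 / (k : ℝ) := by
    have : (0 : ℝ) < k := by exact_mod_cast (show 0 < k by omega)
    positivity
  have hden : 0 < ∫ y in (0 : ℝ)..1, y ^ (k - 1) / ((k - 1).factorial : ℝ)
      * ((derivative^[k] P).eval (1 - y)) ^ 2 := by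
    by_contra hle
    push Not at hle
    have := mul_nonpos_of_nonneg_of_nonpos hk0.le hle
    linarith
  rw [div_lt_iff₀ hden]
  linarith

/-! ### Polymath 8b Proposition 6.5: discharge of `Polymath2014_epsFunctional_le`

The named fact `Literature.Barriers.Parity.Polymath2014_epsFunctional_le` — "For any `k ≥ 2` and `0 ≤ ε < 1`
we have `M_{k,ε} ≤ (k/(k-1)) log(2k-1)`" (D. H. J. Polymath, *Variants of the Selberg sieve, and bounded
intervals containing many primes*, Res. Math. Sci. 1:12 (2014) = arXiv:1407.4897, Proposition 6.5,
pp. 24–25), rendered on the tree's `polymathFunctional` / `IsPolymathTestFunction` — is PROVED in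
`Literature/NumberTheory/Sieve/PolymathMkEpsUpperBound.lean`
(`Literature.NumberTheory.Sieve.polymathFunctional_le_log`).  Note on the source (details in that module's
docstring): the printed proof sums the fibrewise Cauchy–Schwarz inequalities with the weight `1 - σ + k tᵢ`
of Corollary 6.4 as if `∑ᵢ 1_{Eᵢ}(1 - σ + k tᵢ) ≤ k` held pointwise (`Eᵢ = {∑_{j≠i} tⱼ ≤ 1-ε}`); on
`1 < σ ≤ 1 + ε` this multiplier reaches `k + (k-1)ε`, so the printed weights give only
`((k + (k-1)ε)/(k-1)) log(2k-1)`.  The tree's proof completes the argument with a two-zone weight family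
(`PolymathMkEpsWeights.lean`: Corollary 6.4's affine weight on `{σ ≤ τ}` and a counting weight beyond,
`τ ∈ {1, 1-ε}`) and sharp harmonic-sum numerics (`PolymathMkEpsHarmonic.lean`); the STATEMENT is as
printed and is not weakened. -/

/-- **Polymath 8b, Proposition 6.5 holds**: `M_{k,ε} ≤ (k/(k-1)) log(2k-1)` for every `k ≥ 2`, `0 ≤ ε < 1`
and every test function of Theorem 3.12 — by `Literature.NumberTheory.Sieve.polymathFunctional_le_log`
(weighted Cauchy–Schwarz on the fibres of `J_{i,1-ε}` with the two-zone weights completing the printed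
argument). [cite: Polymath8b2014, Proposition 6.5] -/
theorem Polymath2014_epsFunctional_le_holds : Polymath2014_epsFunctional_le :=
  fun _k hk _ε hε0 hε1 _F hF =>
    Literature.NumberTheory.Sieve.polymathFunctional_le_log hk hε0 hε1 hF

/-- **No prime pairs from Theorem 3.12 with `k ≤ 23` at Bombieri–Vinogradov level (unconditional form of
`not_polymathCriterion_pairs_of_le_half`).**  For `0 < θ ≤ 1/2`, `0 ≤ ε < 1` and `2 ≤ k ≤ 23` no test
function on `(1+ε)·R_k` has `(∑ᵢ J_{i,1-ε}(F))/I(F) > 2/θ ≥ 4`, since `M_{k,ε} ≤ (k/(k-1)) log(2k-1) < 4`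
there (`epsCeiling_lt_four`); the printed use of Theorem 3.12 at this level is `k = 50`, `ε = 1/25`
(`M_{50,1/25} > 4.0043`). [cite: Polymath8b2014, Proposition 6.5 and Theorem 3.13(i)] -/
theorem not_polymathCriterion_pairs_of_le_half_holds {θ ε : ℝ} (hθ : 0 < θ) (hθ2 : θ ≤ 1 / 2)
    (hε0 : 0 ≤ ε) (hε1 : ε < 1) {k : ℕ} (hk2 : 2 ≤ k) (hk : k ≤ 23) : ¬ PolymathCriterion θ ε k 1 :=
  not_polymathCriterion_pairs_of_le_half Polymath2014_epsFunctional_le_holds hθ hθ2 hε0 hε1 hk2 hk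

end Literature.Barriers.Parity
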